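import Summits.CriticalPhenomena.Ising3DConformalLimit.Theorems.PrecisionLaplacianDirectCorrelationStableTailPickInversionAux4
import Summits.CriticalPhenomena.Ising3DConformalLimit.Theorems.PrecisionLaplacianDirectCorrelationStableTailPickInversionAux

/-!
# Pick inversion, auxiliary file 6: integrability of the Nevanlinna measure near `s = 1`

Helper file for stub `stub_pickInversion` of line `self-energy-pick-inversion`, crux
`PrecisionLaplacian.DirectCorrelationStableTail` (stmt-CriticalPhenomena-4799). Pure theorem file.

If `A(x) = b + βx + π⁻¹ ∫ (1/(s - x) - s/(1 + s²)) dρ(s)` for `x < 1`, with `ρ` carried by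
`[1, ∞)`, `∫ dρ/(1 + s²) < ∞`, and `A ≤ 0` on `[1/2, 1)`, then `ρ` has no atom at `1` and
`∫ dρ(s)/(s(s - 1)) < ∞` (`integrable_inv_mul_sub_one_of_repr`, registered sub-goal
`stub_pickInversion_auxNearOne`): since `A(x) - A(0) - βx = π⁻¹ ∫ x dρ(s)/(s(s - x))` stays bounded
as `x ↑ 1`, monotone convergence applies. Also: `ρ` is σ-finite (`sigmaFinite_of_integrable_inv`),
and the elementary comparison inequalities `(1 + s)/((1 + s²)√(s² - 1)) ≤ 2/(s(s - 1))`,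
`λ(s)/√(s² - 1) ≤ 1/(s(s - 1))` (`s > 1`) used to dominate the Chebyshev coefficients.
-/

noncomputable section

namespace Summit.CriticalPhenomena.Ising3DConformalLimit.Cruxes.DirectCorrelationStableTail.SelfEnergyPickInversion

open MeasureTheory Filter Topology Set Real
open scoped BigOperators ENNReal NNReal
open Literature.Analysis.Complex

/-! ### σ-finiteness and elementary inequalities -/

/-- A measure integrating `(1 + s²)⁻¹` is σ-finite. [folklore] -/
theorem sigmaFinite_of_integrable_inv {ρ : Measure ℝ} (hρ : Integrable (fun s : ℝ => (1 + s ^ 2)⁻¹) ρ) :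
    SigmaFinite ρ := by
  refine Measure.sigmaFinite_of_countable (S := Set.range fun n : ℕ => Set.Icc (-(n : ℝ)) n)
    (Set.countable_range _) ?_ ?_
  · rintro _ ⟨n, rfl⟩
    exact measure_Icc_lt_top_of_integrable hρ _ _
  · apply Set.eq_univ_of_forall fun y => ?_
    obtain ⟨n, hn⟩ := exists_nat_ge |y|
    exact Set.mem_sUnion.2 ⟨_, ⟨n, rfl⟩, abs_le.1 hn⟩

/-- For `s > 1`: `√(s² - 1) ≥ s - 1`, `λ(s) = s - √(s² - 1) ≤ 1/s`, and
`(1 + s)/((1 + s²) √(s² - 1)) ≤ 2/(s (s - 1))`, `λ(s)/√(s² - 1) ≤ 1/(s (s - 1))`. [folklore] -/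
theorem cheb_weight_bounds {s : ℝ} (hs : 1 < s) :
    s - 1 ≤ Real.sqrt (s ^ 2 - 1) ∧ s - Real.sqrt (s ^ 2 - 1) ≤ 1 / s ∧
      (1 + s) / ((1 + s ^ 2) * Real.sqrt (s ^ 2 - 1)) ≤ 2 / (s * (s - 1)) ∧
      (s - Real.sqrt (s ^ 2 - 1)) / Real.sqrt (s ^ 2 - 1) ≤ 1 / (s * (s - 1)) := by
  have hpos : 0 < s ^ 2 - 1 := by nlinarith
  have hsq : Real.sqrt (s ^ 2 - 1) ^ 2 = s ^ 2 - 1 := Real.sq_sqrt hpos.le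
  have hsqrt : 0 < Real.sqrt (s ^ 2 - 1) := Real.sqrt_pos.mpr hpos
  have h1 : s - 1 ≤ Real.sqrt (s ^ 2 - 1) := by
    rw [Real.le_sqrt' (by linarith)]; nlinarith
  obtain ⟨hl0, hl1⟩ := cheb_lambda_mem hs
  have h2 : s - Real.sqrt (s ^ 2 - 1) ≤ 1 / s := by
    rw [le_div_iff₀ (by linarith)]
    nlinarith
  have hs1 : 0 < s - 1 := by linarith
  refine ⟨h1, h2, ?_, ?_⟩
  · rw [div_le_div_iff₀ (by positivity) (by positivity)]
    calc (1 + s) * (s * (s - 1)) ≤ (1 + s) * (s * Real.sqrt (s ^ 2 - 1)) := by gcongr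
      _ ≤ 2 * ((1 + s ^ 2) * Real.sqrt (s ^ 2 - 1)) := by nlinarith
  · rw [div_le_div_iff₀ hsqrt (by positivity)]
    calc (s - Real.sqrt (s ^ 2 - 1)) * (s * (s - 1)) ≤ (1 / s) * (s * (s - 1)) := by gcongr
      _ = s - 1 := by field_simp
      _ ≤ 1 * Real.sqrt (s ^ 2 - 1) := by linarith

/-! ### The kernel difference `k(s, x) - k(s, 0) = x/(s(s - x))` -/

/-- `1/(s - x) - s/(1 + s²) - (1/s - s/(1 + s²)) = x/(s (s - x))` for `s ≠ 0`, `s ≠ x`. [folklore] -/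
theorem nevanlinna_kernel_sub_kernel_zero {s x : ℝ} (hs : s ≠ 0) (hsx : s ≠ x) :
    ((s - x)⁻¹ - s / (1 + s ^ 2)) - ((s - 0)⁻¹ - s / (1 + s ^ 2)) = x / (s * (s - x)) := by
  have : s - x ≠ 0 := sub_ne_zero.2 hsx
  field_simp
  ring

/-- Integrability of the real Nevanlinna kernel `s ↦ 1/(s - x) - s/(1 + s²)` against a measure on
`[1, ∞)` integrating `(1 + s²)⁻¹`, for `x < 1`. [folklore] -/
theorem integrable_real_nevanlinna_kernel {ρ : Measure ℝ}
    (hρ : Integrable (fun s : ℝ => (1 + s ^ 2)⁻¹) ρ) (hρ1 : ρ (Set.Iio 1) = 0) {x : ℝ} (hx : x < 1) :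
    Integrable (fun s : ℝ => (s - x)⁻¹ - s / (1 + s ^ 2)) ρ := by
  have hae : ∀ᵐ s ∂ρ, 1 ≤ s := by
    rw [ae_iff]; simp only [not_le]; exact hρ1
  set C : ℝ := (1 + (|x| + 1) ^ 2) / (1 - x) + (|x| + 1) with hC
  refine Integrable.mono' (hρ.const_mul C) (Measurable.aestronglyMeasurable (by fun_prop)) ?_
  filter_upwards [hae] with s hs
  have h := norm_nevanlinna_kernel_le_of_re_lt hx hs (z := (x : ℂ)) (by simp) (by simp)
  have hk : ((s : ℂ) - x)⁻¹ - (s : ℂ) / (1 + (s : ℂ) ^ 2) = (((s - x)⁻¹ - s / (1 + s ^ 2) : ℝ) : ℂ) := by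
    push_cast; rfl
  rw [hk, Complex.norm_real] at h
  exact h

/-! ### No atom at `1` and integrability of `1/(s(s-1))` -/

/-- If `ρ` charges neither `(-∞, 1)` nor `{1}` then `ρ`-a.e. `s > 1`. [folklore] -/
theorem ae_one_lt_of_null {ρ : Measure ℝ} (hρ1 : ρ (Set.Iio 1) = 0) (hρ2 : ρ {1} = 0) :
    ∀ᵐ s ∂ρ, 1 < s := by
  rw [ae_iff]
  refine measure_mono_null (fun s hs => ?_) (measure_union_null hρ1 hρ2)
  simp only [Set.mem_setOf_eq, not_lt] at hs
  rcases hs.lt_or_eq with h | h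
  · exact Or.inl h
  · exact Or.inr h


/-- **Integrability of the Nevanlinna measure near `s = 1`.** Let `ρ` be carried by `[1, ∞)` with
`∫ dρ/(1 + s²) < ∞`, and suppose `A(x) = b + βx + π⁻¹ ∫ (1/(s - x) - s/(1 + s²)) dρ(s)` for all
`x < 1`, where `A ≤ 0` on `[1/2, 1)`. Then `ρ({1}) = 0` and `∫ dρ(s)/(s(s - 1)) < ∞`
(monotone convergence along `x ↑ 1` applied to `∫ x dρ(s)/(s(s - x)) = π(A(x) - A(0)) - πβx`,
which stays bounded). [folklore] -/
theorem integrable_inv_mul_sub_one_of_repr {A : ℝ → ℝ} {b β : ℝ} {ρ : Measure ℝ}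
    (hρ : Integrable (fun s : ℝ => (1 + s ^ 2)⁻¹) ρ) (hρ1 : ρ (Set.Iio 1) = 0)
    (hA : ∀ x : ℝ, x < 1 → A x = b + β * x + π⁻¹ * ∫ s, ((s - x)⁻¹ - s / (1 + s ^ 2)) ∂ρ)
    (hAle : ∀ x : ℝ, 1 / 2 ≤ x → x < 1 → A x ≤ 0) :
    ρ {1} = 0 ∧ Integrable (fun s : ℝ => (s * (s - 1))⁻¹) ρ := by
  have hπ := Real.pi_pos
  have hae : ∀ᵐ s ∂ρ, 1 ≤ s := by
    rw [ae_iff]; simp only [not_le]; exact hρ1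
  -- the sequence `x_m = 1 - 1/(m+2) ∈ [1/2, 1)`
  set xs : ℕ → ℝ := fun m => 1 - 1 / ((m : ℝ) + 2) with hxs
  have hxs_lt : ∀ m, xs m < 1 := fun m => by
    simp only [hxs]; have : (0 : ℝ) < 1 / ((m : ℝ) + 2) := by positivity
    linarith
  have hxs_ge : ∀ m, 1 / 2 ≤ xs m := fun m => by
    simp only [hxs]
    have : 1 / ((m : ℝ) + 2) ≤ 1 / 2 := by
      rw [div_le_div_iff₀ (by positivity) (by positivity)]; linarith [(Nat.cast_nonneg m : (0:ℝ) ≤ m)]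
    linarith
  have hxs_mono : Monotone xs := fun m m' hmm' => by
    simp only [hxs]
    have h1 : (0 : ℝ) < (m : ℝ) + 2 := by positivity
    have : 1 / ((m' : ℝ) + 2) ≤ 1 / ((m : ℝ) + 2) :=
      div_le_div_of_nonneg_left zero_le_one h1 (by exact_mod_cast Nat.add_le_add_right hmm' 2)
    linarith
  have hxs_lim : Tendsto xs atTop (𝓝 1) := by
    have h : Tendsto (fun m : ℕ => 1 / ((m : ℝ) + 2)) atTop (𝓝 0) :=
      tendsto_const_nhds.div_atTop (tendsto_atTop_add_const_right _ _ tendsto_natCast_atTop_atTop)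
    have h2 : Tendsto (fun m : ℕ => (1 : ℝ) - 1 / ((m : ℝ) + 2)) atTop (𝓝 (1 - 0)) :=
      tendsto_const_nhds.sub h
    simpa [hxs] using h2
  -- the bounded quantity `∫ x dρ/(s(s-x)) = π (A x - A 0) - π β x ≤ B`
  set B : ℝ := π * (0 - A 0) + π * |β| with hB
  have hdiff : ∀ m, ∫ s, xs m / (s * (s - xs m)) ∂ρ ≤ B := by
    intro m
    have hx1 := hxs_lt m
    have hint1 := integrable_real_nevanlinna_kernel hρ hρ1 hx1
    have hint0 := integrable_real_nevanlinna_kernel hρ hρ1 (zero_lt_one)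
    have heq : ∫ s, xs m / (s * (s - xs m)) ∂ρ =
        (∫ s, ((s - xs m)⁻¹ - s / (1 + s ^ 2)) ∂ρ) - ∫ s, ((s - 0)⁻¹ - s / (1 + s ^ 2)) ∂ρ := by
      rw [← integral_sub hint1 (by simpa using hint0)]
      refine integral_congr_ae ?_
      filter_upwards [hae] with s hs
      exact (nevanlinna_kernel_sub_kernel_zero (by linarith) (by linarith)).symm
    have h1 := hA (xs m) hx1
    have h0 := hA 0 zero_lt_one
    simp only [mul_zero, add_zero, sub_zero] at h0
    have hI1 : ∫ s, ((s - xs m)⁻¹ - s / (1 + s ^ 2)) ∂ρ = π * (A (xs m) - b - β * xs m) := by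
      rw [h1]; field_simp; ring
    have hI0 : ∫ s, (s⁻¹ - s / (1 + s ^ 2)) ∂ρ = π * (A 0 - b) := by
      rw [h0]; field_simp; ring
    rw [heq, hI1]
    simp only [sub_zero]
    rw [hI0]
    have hAm := hAle (xs m) (hxs_ge m) hx1
    have : -(π * β * xs m) ≤ π * |β| := by
      have h2 : |β * xs m| ≤ |β| := by
        rw [abs_mul]
        exact mul_le_of_le_one_right (abs_nonneg _) (by rw [abs_of_nonneg (by linarith [hxs_ge m])]; exact hx1.le)
      nlinarith [neg_abs_le (β * xs m), hπ]
    nlinarith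
  -- monotone convergence
  set f : ℕ → ℝ → ℝ≥0∞ := fun m s => ENNReal.ofReal (xs m / (s * (s - xs m))) with hf
  have hf_meas : ∀ m, AEMeasurable (f m) ρ := fun m =>
    (ENNReal.measurable_ofReal.comp (by fun_prop)).aemeasurable
  have hterm_mono : ∀ s : ℝ, 1 ≤ s → Monotone fun m => xs m / (s * (s - xs m)) := by
    intro s hs m m' hmm'
    have hx := hxs_mono hmm'
    have h1 : 0 < s - xs m' := by linarith [hxs_lt m']
    have h2 : 0 < s - xs m := by linarith [hxs_lt m]
    rw [div_le_div_iff₀ (by positivity) (by positivity)]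
    have key : xs m' * (s * (s - xs m)) - xs m * (s * (s - xs m')) = s ^ 2 * (xs m' - xs m) := by ring
    nlinarith [mul_nonneg (sq_nonneg s) (sub_nonneg.2 hx)]
  have hf_mono : ∀ᵐ s ∂ρ, Monotone fun m => f m s := by
    filter_upwards [hae] with s hs
    intro m m' hmm'
    exact ENNReal.ofReal_le_ofReal (hterm_mono s hs hmm')
  have hlint : ∀ m, ∫⁻ s, f m s ∂ρ ≤ ENNReal.ofReal B := by
    intro m
    have hnn : 0 ≤ᵐ[ρ] fun s => xs m / (s * (s - xs m)) := by
      filter_upwards [hae] with s hs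
      exact div_nonneg (by linarith [hxs_ge m]) (mul_nonneg (by linarith) (by linarith [hxs_lt m]))
    have hint : Integrable (fun s => xs m / (s * (s - xs m))) ρ := by
      have h := (integrable_real_nevanlinna_kernel hρ hρ1 (hxs_lt m)).sub
        (integrable_real_nevanlinna_kernel hρ hρ1 zero_lt_one)
      refine h.congr ?_
      filter_upwards [hae] with s hs
      exact nevanlinna_kernel_sub_kernel_zero (by linarith) (by linarith [hxs_lt m])
    rw [hf]
    simp only
    rw [← ofReal_integral_eq_lintegral_ofReal hint hnn]
    exact ENNReal.ofReal_le_ofReal (hdiff m)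
  have hsup : ∫⁻ s, ⨆ m, f m s ∂ρ ≤ ENNReal.ofReal B := by
    rw [lintegral_iSup' hf_meas hf_mono]
    exact iSup_le hlint
  have hW_meas : AEMeasurable (fun s => ⨆ m, f m s) ρ := AEMeasurable.iSup hf_meas
  have hW_lt : ∀ᵐ s ∂ρ, (⨆ m, f m s) < ⊤ :=
    ae_lt_top' hW_meas (ne_top_of_le_ne_top ENNReal.ofReal_ne_top hsup)
  -- at `s = 1` the supremum is infinite
  have hW1 : (⨆ m, f m 1) = ⊤ := by
    apply ENNReal.eq_top_of_forall_nnreal_le fun r => ?_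
    obtain ⟨m, hm⟩ := exists_nat_ge (r : ℝ)
    refine le_trans ?_ (le_iSup (fun m => f m 1) m)
    have hval : xs m / (1 * (1 - xs m)) = (m : ℝ) + 1 := by
      simp only [hxs]; field_simp; ring
    simp only [hf, hval]
    rw [← ENNReal.ofReal_coe_nnreal]
    exact ENNReal.ofReal_le_ofReal (by linarith)
  have hρ1' : ρ {1} = 0 := by
    refine measure_mono_null (fun s hs => ?_) (ae_iff.1 hW_lt)
    rw [Set.mem_singleton_iff] at hs
    subst hs
    simp [hW1]
  have hae' : ∀ᵐ s ∂ρ, 1 < s := ae_one_lt_of_null hρ1 hρ1'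
  -- for `s > 1` the supremum dominates `1/(s(s-1))`
  have hW_ge : ∀ s : ℝ, 1 < s → ENNReal.ofReal ((s * (s - 1))⁻¹) ≤ ⨆ m, f m s := by
    intro s hs
    have hcont : ContinuousAt (fun x : ℝ => x / (s * (s - x))) 1 :=
      ContinuousAt.div (by fun_prop) (by fun_prop) (by simp; constructor <;> linarith)
    have hlim : Tendsto (fun m => f m s) atTop (𝓝 (ENNReal.ofReal ((s * (s - 1))⁻¹))) := by
      have h1 := (hcont.tendsto.comp hxs_lim)
      simp only [Function.comp_def] at h1
      have h2 := (ENNReal.continuous_ofReal.tendsto _).comp h1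
      simpa [hf, one_div, Function.comp_def] using h2
    exact le_of_tendsto' hlim fun m => le_iSup (fun m => f m s) m
  refine ⟨hρ1', ⟨(Measurable.aestronglyMeasurable (by fun_prop)), ?_⟩⟩
  -- finite integral
  have hle : ∫⁻ s, ‖(s * (s - 1))⁻¹‖ₑ ∂ρ ≤ ∫⁻ s, ⨆ m, f m s ∂ρ := by
    refine lintegral_mono_ae ?_
    filter_upwards [hae'] with s hs
    have hnn : 0 ≤ (s * (s - 1))⁻¹ := by
      have : 0 < s * (s - 1) := mul_pos (by linarith) (by linarith)
      positivity
    rw [Real.enorm_eq_ofReal hnn]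
    exact hW_ge s hs
  exact lt_of_le_of_lt (hle.trans hsup) ENNReal.ofReal_lt_top

/-- **Registered auxiliary stub `stub_pickInversion_auxNearOne`** (sub-goal of `stub_pickInversion`):
no atom at `1` and integrability of `1/(s(s-1))` for a Nevanlinna measure on `[1, ∞)` whose
transform is bounded above near `1⁻` (`integrable_inv_mul_sub_one_of_repr`). [folklore] -/
theorem stub_pickInversion_auxNearOne : ∀ (A : ℝ → ℝ) (b β : ℝ) (ρ : MeasureTheory.Measure ℝ),
    MeasureTheory.Integrable (fun s : ℝ => (1 + s ^ 2)⁻¹) ρ → ρ (Set.Iio 1) = 0 →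
    (∀ x : ℝ, x < 1 → A x = b + β * x + Real.pi⁻¹ * ∫ s, ((s - x)⁻¹ - s / (1 + s ^ 2)) ∂ρ) →
    (∀ x : ℝ, 1 / 2 ≤ x → x < 1 → A x ≤ 0) →
    ρ {1} = 0 ∧ MeasureTheory.Integrable (fun s : ℝ => (s * (s - 1))⁻¹) ρ :=
  fun _ _ _ _ hρ hρ1 hA hAle => integrable_inv_mul_sub_one_of_repr hρ hρ1 hA hAle

end Summit.CriticalPhenomena.Ising3DConformalLimit.Cruxes.DirectCorrelationStableTail.SelfEnergyPickInversion

end
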